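import Literature.NumberTheory.QuadraticFields.BinaryQuadraticFormsClassNumber
import Mathlib.Algebra.BigOperators.Finprod
import HarnessLib

/-!
# Positive definite forms in the Popa–Zagier half-domain: `∑_Q w(Q) = 12 h_w(D)`

For a negative discriminant `D`, every proper equivalence class of primitive positive definite
forms `Q = (A, B, C)` of discriminant `D` meets the "half fundamental domain"
`𝔽⁺ = {B ≤ 0, |B| ≤ A, |B| ≤ C}` (the root `z_Q` lies in `{0 ≤ Re z ≤ ½, |z − 1| ≥ 1}`, a
fundamental domain of `PSL₂(ℤ)` made of the right half of the standard one and the `S`-image of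
its left half) with total Popa–Zagier weight `1` — boundary points weighted `½`, the corner
`ρ`-type points `⅓` or `⅙` — except for the classes of `x² + y²` (`D = -4`, weight `½`) and
`x² + xy + y²` (`D = -3`, weight `⅓`), whose stabilisers are non-trivial.  Summing over classes,

  `∑_{Q pos. def. primitive, disc Q = D} w(Q) = h_w(D)`,  `h_w(-3) = ⅓`, `h_w(-4) = ½`, `h_w = h`

(`sum_pzWeight`, stated with `pzWeight = 12 w ∈ ℤ`).  This is the count behind the elliptic terms
of the Eichler–Selberg trace formula in the Popa–Zagier approach ([PopaZagier2017, §4 (12), the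
bracket `E`]; [Popa2014, §2.3]).  The proof is a direct combinatorial comparison with Cox's reduced
forms (`|B| ≤ A ≤ C`, `B ≥ 0` on the boundary): the map `pzRed` (identity, `B ↦ -B`, or
`(A, B, C) ↦ (C, -B, A)`) sends `𝔽⁺`-forms to reduced forms, and its fibres have weight `12`
(`6` over `(1, 0, 1)`, `4` over `(1, 1, 1)`).

## References
* [PopaZagier2017] A. Popa, D. Zagier, arXiv:1711.00327, §4 (12).
* [Popa2014] A. Popa, Res. Math. Sci. 5 (2018), §2.3.
* [Cox2013] D. Cox, *Primes of the form x² + ny²*, §2.A, Thm. 2.8.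
-/

namespace Literature.NumberTheory.QuadraticFields.Quadratic

namespace BinQF

variable {D : ℤ}

/-! ### The Popa–Zagier weight of a form -/

/-- `12 ×` the Popa–Zagier weight of `Q = (A, B, C)`: nonzero iff `A, C > 0`, `B ≤ 0`,
`|B| ≤ A`, `|B| ≤ C`; then `6` if `B = 0`, `4` if `|B| = A = C`, `6` if `|B| = A` or `|B| = C`
(exactly one), `12` otherwise. [cite: PopaZagier2017, §4 (12) (bracket E)] -/
def pzWeight (Q : BinQF) : ℤ :=
  if 0 < Q.a ∧ 0 < Q.c ∧ Q.b ≤ 0 ∧ -Q.b ≤ Q.a ∧ -Q.b ≤ Q.c then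
    (if Q.b = 0 then 6 else if -Q.b = Q.c then (if -Q.b = Q.a then 4 else 6)
      else if -Q.b = Q.a then 6 else 12)
  else 0

/-- The reduced form attached to a form of nonzero weight: identity if `A < C` and `B ≠ -A`,
sign flip `B ↦ -B` if `A < C`, `B = -A` or if `A = C`, and `(A, B, C) ↦ (C, -B, A)` if `A > C`.
[cite: Cox2013, §2.A (2.4)] -/
def pzRed (Q : BinQF) : BinQF :=
  if Q.a < Q.c then (if Q.b = -Q.a then ⟨Q.a, -Q.b, Q.c⟩ else Q)
  else if Q.c < Q.a then ⟨Q.c, -Q.b, Q.a⟩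
  else ⟨Q.a, -Q.b, Q.c⟩

/-- Support of the weight. [folklore] -/
theorem pzWeight_ne_zero_iff (Q : BinQF) :
    pzWeight Q ≠ 0 ↔ 0 < Q.a ∧ 0 < Q.c ∧ Q.b ≤ 0 ∧ -Q.b ≤ Q.a ∧ -Q.b ≤ Q.c := by
  unfold pzWeight
  constructor
  · intro h
    by_contra hc
    exact h (if_neg hc)
  · intro h
    rw [if_pos h]
    split_ifs <;> omega

/-- The sign flip preserves discriminants. [folklore] -/
theorem disc_flip (Q : BinQF) : (⟨Q.a, -Q.b, Q.c⟩ : BinQF).disc = Q.disc := by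
  simp [disc]

/-- `(C, -B, A)` has the same discriminant. [folklore] -/
theorem disc_swap (Q : BinQF) : (⟨Q.c, -Q.b, Q.a⟩ : BinQF).disc = Q.disc := by
  simp [disc]; ring

/-- The sign flip preserves primitivity. [folklore] -/
theorem isPrimitive_flip {Q : BinQF} (h : Q.IsPrimitive) : (⟨Q.a, -Q.b, Q.c⟩ : BinQF).IsPrimitive := by
  unfold IsPrimitive at h ⊢
  simpa using h

/-- `(C, -B, A)` is primitive if `(A, B, C)` is. [folklore] -/
theorem isPrimitive_swap {Q : BinQF} (h : Q.IsPrimitive) : (⟨Q.c, -Q.b, Q.a⟩ : BinQF).IsPrimitive := by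
  unfold IsPrimitive at h ⊢
  simp only [Int.natAbs_neg]
  rwa [Nat.gcd_comm, Nat.gcd_left_comm, Nat.gcd_comm]

/-- **`pzRed` lands in reduced forms.** [cite: Cox2013, §2.A (2.4)] -/
theorem pzRed_mem {Q : BinQF} (hQ : Q.IsPosPrim D) (hw : pzWeight Q ≠ 0) :
    (pzRed Q).IsPosPrim D ∧ (pzRed Q).IsReduced := by
  obtain ⟨ha, hc, hb, hba, hbc⟩ := (pzWeight_ne_zero_iff Q).mp hw
  obtain ⟨hdisc, -, hprim⟩ := hQ
  unfold pzRed IsReduced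
  by_cases h1 : Q.a < Q.c
  · rw [if_pos h1]
    by_cases h2 : Q.b = -Q.a
    · rw [if_pos h2]
      refine ⟨⟨by rw [disc_flip, hdisc], ha, isPrimitive_flip hprim⟩, ?_, ?_, ?_⟩
      · show |(-Q.b)| ≤ Q.a; rw [abs_of_nonneg (by omega)]; omega
      · exact h1.le
      · intro _; show 0 ≤ -Q.b; omega
    · rw [if_neg h2]
      refine ⟨⟨hdisc, ha, hprim⟩, ?_, h1.le, ?_⟩
      · rw [abs_of_nonpos hb]; exact hba
      · rintro (h | h)
        · rw [abs_of_nonpos hb] at h; omega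
        · omega
  · rw [if_neg h1]
    by_cases h3 : Q.c < Q.a
    · rw [if_pos h3]
      refine ⟨⟨by rw [disc_swap, hdisc], hc, isPrimitive_swap hprim⟩, ?_, h3.le, ?_⟩
      · show |(-Q.b)| ≤ Q.c; rw [abs_of_nonneg (by omega)]; omega
      · intro _; show 0 ≤ -Q.b; omega
    · rw [if_neg h3]
      have hac : Q.a = Q.c := le_antisymm (not_lt.mp h3) (not_lt.mp h1)
      refine ⟨⟨by rw [disc_flip, hdisc], ha, isPrimitive_flip hprim⟩, ?_, hac.le, ?_⟩
      · show |(-Q.b)| ≤ Q.a; rw [abs_of_nonneg (by omega)]; omega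
      · intro _; show 0 ≤ -Q.b; omega

/-- **The fibres of `pzRed`**: a form of nonzero weight over the reduced form `R = (A, B, C)` is
`R`, `(A, -B, C)` or `(C, -B, A)`. [folklore] -/
theorem eq_of_pzRed_eq {Q R : BinQF} (h : pzRed Q = R) :
    Q = R ∨ Q = ⟨R.a, -R.b, R.c⟩ ∨ Q = ⟨R.c, -R.b, R.a⟩ := by
  unfold pzRed at h
  split_ifs at h with h1 h2 h3
  · right; left; rw [← h]; ext <;> simp
  · left; exact h
  · right; right; rw [← h]; ext <;> simp
  · right; left; rw [← h]; ext <;> simp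

/-! ### Finite sets of forms -/

/-- A box of forms containing all positive definite forms of discriminant `D` of nonzero weight.
[folklore] -/
noncomputable def pzBox (D : ℤ) : Finset BinQF :=
  ((Finset.Icc (1 : ℤ) D.natAbs ×ˢ Finset.Icc (-(D.natAbs : ℤ)) 0) ×ˢ Finset.Icc (1 : ℤ) D.natAbs).image
    fun p => ⟨p.1.1, p.1.2, p.2⟩

/-- The primitive positive definite forms of discriminant `D` of nonzero weight ("in `𝔽⁺`").
[cite: PopaZagier2017, §4 (12)] -/
noncomputable def pzSet (D : ℤ) : Finset BinQF := (pzBox D).filter fun Q => Q.IsPosPrim D ∧ pzWeight Q ≠ 0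

/-- Coefficient bounds on forms of nonzero weight: `A, |B|, C ≤ |D|`. [folklore] -/
theorem bounds_of_pzWeight_ne_zero {Q : BinQF} (hdisc : Q.disc = D) (hw : pzWeight Q ≠ 0) :
    0 < Q.a ∧ Q.a ≤ D.natAbs ∧ -(D.natAbs : ℤ) ≤ Q.b ∧ Q.b ≤ 0 ∧ 0 < Q.c ∧ Q.c ≤ D.natAbs := by
  obtain ⟨ha, hc, hb, hba, hbc⟩ := (pzWeight_ne_zero_iff Q).mp hw
  unfold disc at hdisc
  have hb2 : Q.b * Q.b ≤ Q.a * Q.c := by nlinarith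
  have hD : (D.natAbs : ℤ) = -D := by
    have : D < 0 := by nlinarith
    rw [Int.ofNat_natAbs_of_nonpos this.le]
  rw [hD]
  have h3 : 3 * (Q.a * Q.c) ≤ -D := by nlinarith
  refine ⟨ha, by nlinarith, ?_, hb, hc, by nlinarith⟩
  nlinarith

/-- Membership in `pzSet`. [folklore] -/
theorem mem_pzSet_iff {Q : BinQF} : Q ∈ pzSet D ↔ Q.IsPosPrim D ∧ pzWeight Q ≠ 0 := by
  unfold pzSet
  rw [Finset.mem_filter]
  constructor
  · exact fun h => h.2
  · intro h
    refine ⟨?_, h⟩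
    obtain ⟨ha, haD, hbD, hb, hc, hcD⟩ := bounds_of_pzWeight_ne_zero h.1.disc_eq h.2
    unfold pzBox
    simp only [Finset.mem_image, Finset.mem_product, Finset.mem_Icc, Prod.exists]
    exact ⟨Q.a, Q.b, Q.c, ⟨⟨⟨by omega, haD⟩, hbD, hb⟩, by omega, hcD⟩, rfl⟩

/-- The reduced primitive positive definite forms of discriminant `D`, as a finset.
[cite: Cox2013, Thm. 2.8] -/
def redSet (D : ℤ) : Finset BinQF := (reducedFormsList D).toFinset

/-- Membership in `redSet`. [cite: Cox2013, Thm. 2.8] -/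
theorem mem_redSet_iff (hD : D < 0) {R : BinQF} : R ∈ redSet D ↔ R.IsPosPrim D ∧ R.IsReduced := by
  unfold redSet
  rw [List.mem_toFinset, mem_reducedFormsList_iff _ hD]

/-- `#redSet D = h(D)`. [cite: Cox2013, Thm. 2.13] -/
theorem card_redSet (D : ℤ) : (redSet D).card = classNumber D := (classNumber_eq_card D).symm

/-! ### The weights over a reduced form -/

/-- `12 ×` the total weight of the fibre of `pzRed` over a reduced form. [folklore] -/
def fibreWeight (R : BinQF) : ℤ :=
  if R.b = 0 ∧ R.a = R.c then 6 else if R.b = R.a ∧ R.a = R.c then 4 else 12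

/-- **The fibre sum**: the forms of nonzero weight over the reduced form `R` have total weight
`fibreWeight R` (`12`; `6` for `(A, 0, A)`; `4` for `(A, A, A)`). [cite: PopaZagier2017, §4 (12)] -/
theorem sum_fibre_pzWeight (hD : D < 0) {R : BinQF} (hR : R ∈ redSet D) :
    ∑ Q ∈ (pzSet D).filter (fun Q => pzRed Q = R), pzWeight Q = fibreWeight R := by
  obtain ⟨hRp, hRr⟩ := (mem_redSet_iff hD).mp hR
  obtain ⟨hb1, hac, hb2⟩ := hRr
  have ha : 0 < R.a := hRp.a_pos
  -- the three candidates
  set F : BinQF := ⟨R.a, -R.b, R.c⟩ with hF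
  set S' : BinQF := ⟨R.c, -R.b, R.a⟩ with hS'
  have hFp : F.IsPosPrim D := ⟨by rw [hF, disc_flip, hRp.disc_eq], ha, isPrimitive_flip hRp.primitive⟩
  have hS'p : S'.IsPosPrim D :=
    ⟨by rw [hS', disc_swap, hRp.disc_eq], lt_of_lt_of_le ha hac, isPrimitive_swap hRp.primitive⟩
  -- membership of the fibre, candidate by candidate
  have hmem : ∀ Q, Q ∈ (pzSet D).filter (fun Q => pzRed Q = R) ↔
      (Q = R ∨ Q = F ∨ Q = S') ∧ pzWeight Q ≠ 0 ∧ pzRed Q = R := by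
    intro Q
    rw [Finset.mem_filter, mem_pzSet_iff]
    constructor
    · rintro ⟨⟨-, hw⟩, hred⟩
      exact ⟨eq_of_pzRed_eq hred, hw, hred⟩
    · rintro ⟨hQ, hw, hred⟩
      refine ⟨⟨?_, hw⟩, hred⟩
      rcases hQ with rfl | rfl | rfl
      · exact hRp
      · exact hFp
      · exact hS'p
  -- linear consequences of reducedness
  have hbu : R.b ≤ R.a := (abs_le.mp hb1).2
  have hbl : -R.a < R.b := by
    rcases (abs_le.mp hb1).1.lt_or_eq with h | h
    · exact h
    · exfalso
      have := hb2 (Or.inl (by rw [← h, abs_neg, abs_of_pos ha]))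
      omega
  have hbac : R.a = R.c → 0 ≤ R.b := fun h => hb2 (Or.inr h)
  -- evaluate weights and reductions on the candidates
  have wR : pzWeight R = if R.b < 0 then 12 else if R.b = 0 then 6 else 0 := by
    unfold pzWeight; split_ifs <;> omega
  have wF : pzWeight F = if R.b < 0 then 0 else if R.b = 0 then 6 else if R.b = R.c then 4
      else if R.b = R.a then 6 else 12 := by
    unfold pzWeight; simp only [hF]; split_ifs <;> omega
  have wS : pzWeight S' = if R.b < 0 then 0 else if R.b = 0 then 6 else if R.b = R.a then
      (if R.a = R.c then 4 else 6) else 12 := by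
    unfold pzWeight; simp only [hS']; split_ifs <;> omega
  have rR : pzRed R = R ↔ (R.a < R.c ∨ R.b = 0) := by
    unfold pzRed
    constructor
    · intro h; split_ifs at h with h1 h2 h3
      · left; exact h1
      · left; exact h1
      · omega
      · right; have := congrArg BinQF.b h; simp at this; omega
    · intro h; split_ifs with h1 h2 h3
      · exfalso; omega
      · rfl
      · exfalso; omega
      · ext <;> simp; omega
  have rF : pzRed F = R ↔ (R.a = R.c ∨ R.b = R.a ∨ R.b = 0) := by
    unfold pzRed; simp only [hF]
    constructor
    · intro h; split_ifs at h with h1 h2 h3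
      · right; left; omega
      · right; right; have := congrArg BinQF.b h; simp at this; omega
      · omega
      · left; omega
    · intro h; split_ifs with h1 h2 h3
      · ext <;> simp
      · ext <;> simp; omega
      · exfalso; omega
      · ext <;> simp
  have rS : pzRed S' = R := by
    unfold pzRed; simp only [hS']
    split_ifs with h1 h2 h3
    · exfalso; omega
    · exfalso; omega
    · ext <;> simp
    · ext <;> simp <;> omega
  -- distinctness of the candidates
  have eRF : F = R ↔ R.b = 0 := by
    constructor
    · intro h; have := congrArg BinQF.b h; simp [hF] at this; omega
    · intro h; ext <;> simp [hF, h]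
  have eRS : S' = R ↔ R.a = R.c ∧ R.b = 0 := by
    constructor
    · intro h; have h1 := congrArg BinQF.b h; have h2 := congrArg BinQF.a h
      simp [hS'] at h1 h2; omega
    · rintro ⟨h1, h2⟩; ext <;> simp [hS', h1, h2]
  have eFS : S' = F ↔ R.a = R.c := by
    constructor
    · intro h; have := congrArg BinQF.a h; simp [hS', hF] at this; omega
    · intro h; ext <;> simp [hS', hF, h]
  -- case analysis on the sign of `R.b`
  rcases lt_trichotomy R.b 0 with hb | hb | hb
  · -- `R.b < 0`: the fibre is `{R}`
    have hset : (pzSet D).filter (fun Q => pzRed Q = R) = {R} := by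
      ext Q
      rw [hmem, Finset.mem_singleton]
      constructor
      · rintro ⟨hQ, hw, -⟩
        rcases hQ with rfl | rfl | rfl
        · rfl
        · exfalso; rw [wF, if_pos hb] at hw; exact hw rfl
        · exfalso; rw [wS, if_pos hb] at hw; exact hw rfl
      · rintro rfl
        exact ⟨Or.inl rfl, by rw [wR]; split_ifs <;> omega, rR.mpr (Or.inl (by omega))⟩
    rw [hset, Finset.sum_singleton, wR]
    unfold fibreWeight
    split_ifs <;> omega
  · -- `R.b = 0`: the fibre is `{R, S'}`
    have hset : (pzSet D).filter (fun Q => pzRed Q = R) = {R, S'} := by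
      ext Q
      rw [hmem, Finset.mem_insert, Finset.mem_singleton]
      constructor
      · rintro ⟨hQ, -, -⟩
        rcases hQ with rfl | rfl | rfl
        · left; rfl
        · left; exact eRF.mpr hb
        · right; rfl
      · rintro (rfl | rfl)
        · exact ⟨Or.inl rfl, by rw [wR]; split_ifs <;> omega, rR.mpr (Or.inr hb)⟩
        · exact ⟨Or.inr (Or.inr rfl), by rw [wS]; split_ifs <;> omega, rS⟩
    rw [hset]
    by_cases hac' : R.a = R.c
    · rw [show ({R, S'} : Finset BinQF) = {R} by
          rw [eRS.mpr ⟨hac', hb⟩, Finset.insert_eq_of_mem (Finset.mem_singleton_self _)],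
        Finset.sum_singleton, wR]
      unfold fibreWeight
      split_ifs <;> omega
    · rw [Finset.sum_pair (fun h => hac' ((eRS.mp h.symm).1)), wR, wS]
      unfold fibreWeight
      split_ifs <;> omega
  · -- `R.b > 0`: the fibre is `{F, S'}` or `{S'}`
    have hRnot : pzWeight R = 0 := by rw [wR]; split_ifs <;> omega
    by_cases hac' : R.a = R.c
    · -- `F = S'`
      have hset : (pzSet D).filter (fun Q => pzRed Q = R) = {F} := by
        ext Q
        rw [hmem, Finset.mem_singleton]
        constructor
        · rintro ⟨hQ, hw, -⟩
          rcases hQ with rfl | rfl | rfl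
          · exact absurd hRnot hw
          · rfl
          · exact eFS.mpr hac'
        · rintro rfl
          exact ⟨Or.inr (Or.inl rfl), by rw [wF]; split_ifs <;> omega, rF.mpr (Or.inl hac')⟩
      rw [hset, Finset.sum_singleton, wF]
      unfold fibreWeight
      split_ifs <;> omega
    · -- `F ≠ S'`, `R.a < R.c`
      by_cases hbA : R.b = R.a
      · have hset : (pzSet D).filter (fun Q => pzRed Q = R) = {F, S'} := by
          ext Q
          rw [hmem, Finset.mem_insert, Finset.mem_singleton]
          constructor
          · rintro ⟨hQ, hw, -⟩
            rcases hQ with rfl | rfl | rfl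
            · exact absurd hRnot hw
            · left; rfl
            · right; rfl
          · rintro (rfl | rfl)
            · exact ⟨Or.inr (Or.inl rfl), by rw [wF]; split_ifs <;> omega,
                rF.mpr (Or.inr (Or.inl hbA))⟩
            · exact ⟨Or.inr (Or.inr rfl), by rw [wS]; split_ifs <;> omega, rS⟩
        rw [hset, Finset.sum_pair (fun h => hac' (eFS.mp h.symm)), wF, wS]
        unfold fibreWeight
        split_ifs <;> omega
      · have hset : (pzSet D).filter (fun Q => pzRed Q = R) = {S'} := by
          ext Q
          rw [hmem, Finset.mem_singleton]
          constructor
          · rintro ⟨hQ, hw, hred⟩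
            rcases hQ with rfl | rfl | rfl
            · exact absurd hRnot hw
            · exfalso
              rcases rF.mp hred with h | h | h <;> omega
            · rfl
          · rintro rfl
            exact ⟨Or.inr (Or.inr rfl), by rw [wS]; split_ifs <;> omega, rS⟩
        rw [hset, Finset.sum_singleton, wS]
        unfold fibreWeight
        split_ifs <;> omega

/-! ### The total weight -/

/-- The reduced forms of discriminant `-3` and `-4`. [cite: Cox2013, §2.A] -/
theorem redSet_neg_three : redSet (-3) = {⟨1, 1, 1⟩} := by decide

/-- The reduced forms of discriminant `-4`. [cite: Cox2013, §2.A] -/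
theorem redSet_neg_four : redSet (-4) = {⟨1, 0, 1⟩} := by decide

/-- Away from `D = -3, -4` every fibre has weight `12`. [folklore] -/
theorem fibreWeight_eq_twelve (h3 : D ≠ -3) (h4 : D ≠ -4) {R : BinQF} (hR : R.IsPosPrim D) :
    fibreWeight R = 12 := by
  obtain ⟨hdisc, ha, hprim⟩ := hR
  unfold fibreWeight
  unfold IsPrimitive at hprim
  unfold disc at hdisc
  have habs : R.a.natAbs = 1 → R.a = 1 := fun h => by
    have := Int.natAbs_eq R.a; rw [h] at this; omega
  split_ifs with h1 h2
  · exfalso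
    obtain ⟨hb, hac⟩ := h1
    rw [hb, ← hac, Int.natAbs_zero, Nat.gcd_zero_right, Nat.gcd_self] at hprim
    have := habs hprim
    apply h4; rw [← hdisc, hb, ← hac, this]; norm_num
  · exfalso
    obtain ⟨hb, hac⟩ := h2
    rw [hb, ← hac, Nat.gcd_self, Nat.gcd_self] at hprim
    have := habs hprim
    apply h3; rw [← hdisc, hb, ← hac, this]; norm_num
  · rfl

/-- **`∑_{Q ∈ 𝔽⁺, disc Q = D} 12 w(Q) = 12 h_w(D)`**: `4` for `D = -3`, `6` for `D = -4`, and
`12 h(D)` otherwise. [cite: PopaZagier2017, §4 (12); Popa2014, §2.3] -/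
theorem sum_pzWeight (hD : D < 0) :
    ∑ Q ∈ pzSet D, pzWeight Q =
      if D = -3 then 4 else if D = -4 then 6 else 12 * (classNumber D : ℤ) := by
  have hmaps : ∀ Q ∈ pzSet D, pzRed Q ∈ redSet D := fun Q hQ => by
    obtain ⟨hp, hw⟩ := mem_pzSet_iff.mp hQ
    exact (mem_redSet_iff hD).mpr (pzRed_mem hp hw)
  rw [← Finset.sum_fiberwise_of_maps_to hmaps,
    Finset.sum_congr rfl fun R hR => sum_fibre_pzWeight hD hR]
  split_ifs with h3 h4
  · subst h3; rw [redSet_neg_three]; decide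
  · subst h4; rw [redSet_neg_four]; decide
  · rw [Finset.sum_congr rfl fun R hR => fibreWeight_eq_twelve h3 h4 ((mem_redSet_iff hD).mp hR).1,
      Finset.sum_const, card_redSet, nsmul_eq_mul, mul_comm]

/-- The same over `ℚ`, with the weighted class number `h_w(-3) = ⅓`, `h_w(-4) = ½`, `h_w = h`.
[cite: PopaZagier2017, §4 (12); Popa2014, §2.3] -/
theorem sum_pzWeight_rat (hD : D < 0) :
    ∑ Q ∈ pzSet D, (pzWeight Q : ℚ) =
      12 * (if D = -3 then 1 / 3 else if D = -4 then 1 / 2 else (classNumber D : ℚ)) := by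
  rw [← Int.cast_sum, sum_pzWeight hD]
  split_ifs <;> push_cast <;> norm_num

/-- The finitely supported sum over all forms. [cite: PopaZagier2017, §4 (12); Popa2014, §2.3] -/
theorem finsum_pzWeight_rat (hD : D < 0) :
    ∑ᶠ Q : BinQF, (if Q.IsPosPrim D then (pzWeight Q : ℚ) else 0) =
      12 * (if D = -3 then 1 / 3 else if D = -4 then 1 / 2 else (classNumber D : ℚ)) := by
  classical
  rw [← sum_pzWeight_rat hD, finsum_eq_sum_of_support_subset _ (s := pzSet D)]
  · refine Finset.sum_congr rfl fun Q hQ => ?_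
    rw [if_pos (mem_pzSet_iff.mp hQ).1]
  · intro Q hQ
    rw [Function.mem_support] at hQ
    rw [Finset.mem_coe, mem_pzSet_iff]
    by_cases hp : Q.IsPosPrim D
    · rw [if_pos hp] at hQ
      exact ⟨hp, by exact_mod_cast hQ⟩
    · rw [if_neg hp] at hQ
      exact absurd rfl hQ

end BinQF

end Literature.NumberTheory.QuadraticFields.Quadratic
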